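import Summits.CriticalPhenomena.SAWScalingLimit.Theorems.SAWTotalPositivityBoundaryTP2Defs
import Summits.CriticalPhenomena.SAWScalingLimit.Theorems.SAWTotalPositivityBoundaryTP2Kernel
import Summits.CriticalPhenomena.SAWScalingLimit.Theorems.SAWTotalPositivityBoundaryTP2Symmetry
import Summits.CriticalPhenomena.SAWScalingLimit.Theorems.SAWTotalPositivityBoundaryTP2LadderRung
import Summits.CriticalPhenomena.SAWScalingLimit.Theorems.SAWTotalPositivityBoundaryTP2LadderKernelsInterior
import Summits.CriticalPhenomena.SAWScalingLimit.Theorems.EdgeOfPositivity.Negative.EdgeOfPositivityRectDomain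
import HarnessLib

/-!
# Crux `BoundaryTP2` (stmt-CriticalPhenomena-7115), line `Sketch`: two bottom sites, the far top
site and the top site above the second bottom site of a ladder, crossing pairing vs adjacent pairing

Tool stub `stub_ladder_bbtt9_adjacent` of the line's skeleton: on the ladder
`R_L = discreteDomainGraph (rectDomain L 1) 1` (sites `{0..L} × {0,1}`), for the boundary quadruple
`q₁ = (c₁,0)`, `q₂ = (c₂,0)` on the bottom row, `q₃ = (d₁,1)` on the top row and `q₄ = (c₂,1)`
above `q₂`, with `c₁ < c₂ < d₁ ≤ L` (cyclic order `q₁, q₂, q₃, q₄`) and `0 ≤ x ≤ 1/2`, the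
crossing pairing weighs at most the adjacent one:

  `Z((c₁,0),(d₁,1)) Z((c₂,0),(c₂,1)) ≤ Z((c₁,0),(c₂,0)) Z((d₁,1),(c₂,1))`,  `Z = pathKernel R_L x`.

Proof. Write `E_k = Σ_{d<k} x^{2d+3}`, `P = 1 + x`, `M = 1 - x`, and for a column `c`
`a_c = P + E_c`, `a'_c = M - E_c`, `b_c = P + E_{L-c}`, `b'_c = M - E_{L-c}`. By
`stub_ladderKernels_interior` the two-point kernels between different columns `i < j`,
`j - i = n + 1`, have the rank-two form `x^{n+1}/2 · (a_i b_j P^n ± a'_i b'_j M^n)` (`+` on a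
common row, `-` on opposite rows; `bbtt9Adj_kernel_same`, `bbtt9Adj_kernel_cross`, the top pair
after `pathKernel_comm`), and by `stub_ladderRung` the rung at column `c₂` is
`R = x + E_{c₂} + E_{L-c₂}`. With `u + 1 = c₂ - c₁`, `m + 1 = d₁ - c₂`, `S = Z((c₁,0),(c₂,0))`,
`U = Z((c₂,1),(d₁,1))`, `W = Z((c₁,0),(d₁,1))` one has the exact residual identity (`ring`)

  `4 P M (S U - W R) = x^{u+1} x^{m+1} [a_{c₁} a'_{c₂} P^{u+1} + a'_{c₁} a_{c₂} M^{u+1}] ·`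
  `    [b'_{c₂} b_{d₁} P^{m+1} + b_{c₂} b'_{d₁} M^{m+1}] - 4 x E_{c₂} E_{L-c₂} W`

(the Cauchy–Binet determinant of the rank-two parts against the rung excess
`x E_{c₂} E_{L-c₂} /(P M)`). Since `0 ≤ E_k ≤ 1/6` on `[0, 1/2]` (`E_k (1-x²) ≤ x³`), all of
`a, a', b, b', M` are nonnegative, so the two brackets are at least their first terms and
`W ≤ x^{u+m+2}/2 · a_{c₁} b_{d₁} P^{u+m+1}`; the residual inequality then reduces to the scalar
bound `2 x E_{c₂} E_{L-c₂} ≤ a'_{c₂} b'_{c₂} P`, i.e. `2 · (1/2) · (1/6)² ≤ (1/3)² · 1`. Hence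
`W R ≤ S U` as real numbers, and the bound transfers to `ℝ≥0∞` (`ENNReal.ofReal_mul`,
`ENNReal.ofReal_le_ofReal`).
-/

noncomputable section

namespace Summit.CriticalPhenomena.SAWScalingLimit.Theorems.BoundaryTP2

open Literature.Probability.LatticeModels Literature.Probability.RandomPlanarGeometry
open Summit.CriticalPhenomena.SAWScalingLimit.Theorems.EdgeOfPositivity.Negative
open scoped ENNReal

/-! ## The excursion sums `E_k = Σ_{d<k} x^{2d+3}` (adapted from `…LadderBbttAdjacent`) -/

/-- `E_k ≥ 0` for `x ≥ 0`. [folklore] -/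
private theorem bbtt9Adj_E_nonneg {x : ℝ} (hx : 0 ≤ x) (k : ℕ) :
    0 ≤ ∑ d ∈ Finset.range k, x ^ (2 * d + 3) :=
  Finset.sum_nonneg fun _ _ => pow_nonneg hx _

/-- Telescoping: `E_k (1 - x²) + x^{2k+3} = x³`. [folklore] -/
private theorem bbtt9Adj_E_telescope (x : ℝ) (k : ℕ) :
    (∑ d ∈ Finset.range k, x ^ (2 * d + 3)) * (1 - x ^ 2) + x ^ (2 * k + 3) = x ^ 3 := by
  induction k with
  | zero => simp
  | succ k ih =>
    rw [Finset.sum_range_succ]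
    linear_combination ih

/-- `E_k ≤ 1/6` for `0 ≤ x ≤ 1/2` (from `E_k (1 - x²) ≤ x³ ≤ 1/8` and `1 - x² ≥ 3/4`).
[folklore] -/
private theorem bbtt9Adj_E_le {x : ℝ} (hx0 : 0 ≤ x) (hx : x ≤ 1 / 2) (k : ℕ) :
    ∑ d ∈ Finset.range k, x ^ (2 * d + 3) ≤ 1 / 6 := by
  have h := bbtt9Adj_E_telescope x k
  have hE := bbtt9Adj_E_nonneg hx0 k
  have hk : 0 ≤ x ^ (2 * k + 3) := pow_nonneg hx0 _
  have hx2 : x ^ 2 ≤ (1 / 2) ^ 2 := pow_le_pow_left₀ hx0 hx 2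
  have hx3 : x ^ 3 ≤ (1 / 2) ^ 3 := pow_le_pow_left₀ hx0 hx 3
  norm_num at hx2 hx3
  nlinarith [mul_nonneg hE (by linarith : (0 : ℝ) ≤ 1 / 4 - x ^ 2)]

/-! ## The rank-two form of the ladder kernels (adapted from `…LadderBbttAdjacent`) -/

/-- Same-row kernels of the ladder `{0..L}×{0,1}` in rank-two form: for `i + n + 1 = j ≤ L`, a row
`r ∈ {0,1}` and `x ≥ 0`, `Z_{R_L}((i,r),(j,r)) = x^{n+1}/2 · (a_i b_j (1+x)^n + a'_i b'_j (1-x)^n)` with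
`a_i = 1+x+E_i`, `a'_i = 1-x-E_i`, `b_j = 1+x+E_{L-j}`, `b'_j = 1-x-E_{L-j}` (a regrouping of
`stub_ladderKernels_interior`). [folklore] -/
private theorem bbtt9Adj_kernel_same (L i j n : ℕ) (hn : i + n + 1 = j) (hjL : j ≤ L) {x : ℝ}
    (hx : 0 ≤ x) (r : ℤ) (hr : r = 0 ∨ r = 1) :
    pathKernel (discreteDomainGraph (rectDomain L 1) 1) x (st i r) (st j r) =
      ENNReal.ofReal (x ^ (n + 1) / 2 *
        ((1 + x + ∑ d ∈ Finset.range i, x ^ (2 * d + 3)) *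
              (1 + x + ∑ d ∈ Finset.range (L - j), x ^ (2 * d + 3)) * (1 + x) ^ n +
          (1 - x - ∑ d ∈ Finset.range i, x ^ (2 * d + 3)) *
              (1 - x - ∑ d ∈ Finset.range (L - j), x ^ (2 * d + 3)) * (1 - x) ^ n)) := by
  -- adapted from `…BoundaryTP2LadderBbttAdjacent` (`ladderBbtt_kernel_same`)
  rw [stub_ladderKernels_interior L i j (by omega) hjL hx r r hr hr, if_pos rfl]
  congr 1
  subst hn
  have e1 : i + n + 1 - i = n + 1 := by omega
  have e2 : n + 1 - 1 = n := rfl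
  rw [e1, e2]
  ring

/-- Opposite-row kernels of the ladder `{0..L}×{0,1}` in rank-two form: for `i + n + 1 = j ≤ L`
and `x ≥ 0`, `Z_{R_L}((i,0),(j,1)) = x^{n+1}/2 · (a_i b_j (1+x)^n - a'_i b'_j (1-x)^n)` (a regrouping
of `stub_ladderKernels_interior`). [folklore] -/
private theorem bbtt9Adj_kernel_cross (L i j n : ℕ) (hn : i + n + 1 = j) (hjL : j ≤ L) {x : ℝ}
    (hx : 0 ≤ x) :
    pathKernel (discreteDomainGraph (rectDomain L 1) 1) x (st i 0) (st j 1) =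
      ENNReal.ofReal (x ^ (n + 1) / 2 *
        ((1 + x + ∑ d ∈ Finset.range i, x ^ (2 * d + 3)) *
              (1 + x + ∑ d ∈ Finset.range (L - j), x ^ (2 * d + 3)) * (1 + x) ^ n -
          (1 - x - ∑ d ∈ Finset.range i, x ^ (2 * d + 3)) *
              (1 - x - ∑ d ∈ Finset.range (L - j), x ^ (2 * d + 3)) * (1 - x) ^ n)) := by
  -- adapted from `…BoundaryTP2LadderBbttAdjacent` (`ladderBbtt_kernel_cross`)
  rw [stub_ladderKernels_interior L i j (by omega) hjL hx 0 1 (Or.inl rfl) (Or.inr rfl),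
    if_neg (by norm_num)]
  congr 1
  subst hn
  have e1 : i + n + 1 - i = n + 1 := by omega
  have e2 : n + 1 - 1 = n := rfl
  rw [e1, e2]
  ring

/-! ## Real inequalities in the rank-two variables -/

/-- The correction part `a' b' (1-x)^k` of a kernel is nonnegative (`a', b', 1-x ≥ 0` for
`x ≤ 1/2`, `e, f ≤ 1/6`). [folklore] -/
private theorem bbtt9Adj_sub_nonneg {x e f : ℝ} (k : ℕ) (hx : x ≤ 1 / 2) (he : e ≤ 1 / 6)
    (hf : f ≤ 1 / 6) : 0 ≤ (1 - x - e) * (1 - x - f) * (1 - x) ^ k :=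
  mul_nonneg (mul_nonneg (by linarith) (by linarith)) (pow_nonneg (by linarith) k)

/-- The correction part is at most the main part: `a' b' (1-x)^k ≤ a b (1+x)^k`. [folklore] -/
private theorem bbtt9Adj_sub_le_main {x e f : ℝ} (k : ℕ) (hx0 : 0 ≤ x) (hx : x ≤ 1 / 2)
    (he0 : 0 ≤ e) (hf0 : 0 ≤ f) (hf : f ≤ 1 / 6) :
    (1 - x - e) * (1 - x - f) * (1 - x) ^ k ≤ (1 + x + e) * (1 + x + f) * (1 + x) ^ k :=
  -- adapted from `…BoundaryTP2LadderBbttAdjacent` (`ladderBbtt_sub_le_main`)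
  mul_le_mul (mul_le_mul (by linarith) (by linarith) (by linarith) (by linarith))
    (pow_le_pow_left₀ (by linarith) (by linarith) k) (pow_nonneg (by linarith) k)
    (mul_nonneg (by linarith) (by linarith))

/-- The rank-two form of an opposite-row kernel is nonnegative. [folklore] -/
private theorem bbtt9Adj_cross_nonneg {x e f : ℝ} (k : ℕ) (hx0 : 0 ≤ x) (hx : x ≤ 1 / 2)
    (he0 : 0 ≤ e) (hf0 : 0 ≤ f) (hf : f ≤ 1 / 6) :
    0 ≤ x ^ (k + 1) / 2 *
      ((1 + x + e) * (1 + x + f) * (1 + x) ^ k - (1 - x - e) * (1 - x - f) * (1 - x) ^ k) :=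
  mul_nonneg (by positivity) (sub_nonneg.2 (bbtt9Adj_sub_le_main k hx0 hx he0 hf0 hf))

/-- An opposite-row kernel is at most its main part. [folklore] -/
private theorem bbtt9Adj_cross_upper {x e f : ℝ} (k : ℕ) (hx0 : 0 ≤ x) (hx : x ≤ 1 / 2)
    (he : e ≤ 1 / 6) (hf : f ≤ 1 / 6) :
    x ^ (k + 1) / 2 *
        ((1 + x + e) * (1 + x + f) * (1 + x) ^ k - (1 - x - e) * (1 - x - f) * (1 - x) ^ k) ≤
      x ^ (k + 1) / 2 * ((1 + x + e) * (1 + x + f) * (1 + x) ^ k) :=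
  mul_le_mul_of_nonneg_left (sub_le_self _ (bbtt9Adj_sub_nonneg k hx he hf)) (by positivity)

/-- The rank-two form of a same-row kernel is nonnegative. [folklore] -/
private theorem bbtt9Adj_same_nonneg {x e f : ℝ} (k : ℕ) (hx0 : 0 ≤ x) (hx : x ≤ 1 / 2)
    (he0 : 0 ≤ e) (he : e ≤ 1 / 6) (hf0 : 0 ≤ f) (hf : f ≤ 1 / 6) :
    0 ≤ x ^ (k + 1) / 2 *
      ((1 + x + e) * (1 + x + f) * (1 + x) ^ k + (1 - x - e) * (1 - x - f) * (1 - x) ^ k) :=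
  mul_nonneg (by positivity) (add_nonneg (by positivity) (bbtt9Adj_sub_nonneg k hx he hf))

/-- The scalar bound behind the residual inequality: `2 x e f ≤ (1 - x - e)(1 - x - f)(1 + x)` for
`0 ≤ x ≤ 1/2` and `0 ≤ e, f ≤ 1/6` (`2 · (1/2) · (1/6)² = 1/36 ≤ 1/9 = (1/3)² · 1`). [folklore] -/
private theorem bbtt9Adj_scalar {x e f : ℝ} (hx0 : 0 ≤ x) (hx : x ≤ 1 / 2) (he0 : 0 ≤ e)
    (he : e ≤ 1 / 6) (hf0 : 0 ≤ f) (hf : f ≤ 1 / 6) :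
    2 * x * e * f ≤ (1 - x - e) * (1 - x - f) * (1 + x) := by
  have h1 : x * e ≤ 1 / 2 * (1 / 6) := mul_le_mul hx he he0 (by norm_num)
  have h2 : x * e * f ≤ 1 / 2 * (1 / 6) * (1 / 6) := mul_le_mul h1 hf hf0 (by norm_num)
  have h3 : (1 / 3 : ℝ) * (1 / 3) ≤ (1 - x - e) * (1 - x - f) :=
    mul_le_mul (by linarith) (by linarith) (by norm_num) (by linarith)
  have h4 : (1 / 3 : ℝ) * (1 / 3) * 1 ≤ (1 - x - e) * (1 - x - f) * (1 + x) :=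
    mul_le_mul h3 (by linarith) (by norm_num) (by linarith)
  linarith

/-- The real inequality behind `stub_ladder_bbtt9_adjacent`, in the rank-two variables
`e₁ = E_{c₁}`, `e₂ = E_{c₂}`, `f₂ = E_{L-c₂}`, `f₃ = E_{L-d₁}`, spans `c₂ - c₁ = u+1`,
`d₁ - c₂ = m+1` (so `d₁ - c₁ = (u+m+1)+1`): `W R ≤ S U` for the crossing kernel `W`, the rung `R`,
the bottom kernel `S` and the top kernel `U`. The residual identity
`4PM(SU - WR) = x^{u+1}x^{m+1}[a₁a'₂P^{u+1} + a'₁a₂M^{u+1}][b'₂b₃P^{m+1} + b₂b'₃M^{m+1}] - 4xe₂f₂W`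
is `ring`; its right-hand side is nonnegative by `bbtt9Adj_cross_upper` and `bbtt9Adj_scalar`.
[folklore] -/
private theorem bbtt9Adj_real {x e₁ e₂ f₂ f₃ : ℝ} (u m : ℕ) (hx0 : 0 ≤ x) (hx : x ≤ 1 / 2)
    (he₁ : 0 ≤ e₁) (he₁' : e₁ ≤ 1 / 6) (he₂ : 0 ≤ e₂) (he₂' : e₂ ≤ 1 / 6) (hf₂ : 0 ≤ f₂)
    (hf₂' : f₂ ≤ 1 / 6) (hf₃ : 0 ≤ f₃) (hf₃' : f₃ ≤ 1 / 6) :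
    x ^ (u + m + 1 + 1) / 2 *
          ((1 + x + e₁) * (1 + x + f₃) * (1 + x) ^ (u + m + 1) -
            (1 - x - e₁) * (1 - x - f₃) * (1 - x) ^ (u + m + 1)) *
        (x + e₂ + f₂) ≤
      x ^ (u + 1) / 2 *
          ((1 + x + e₁) * (1 + x + f₂) * (1 + x) ^ u + (1 - x - e₁) * (1 - x - f₂) * (1 - x) ^ u) *
        (x ^ (m + 1) / 2 *
          ((1 + x + e₂) * (1 + x + f₃) * (1 + x) ^ m +
            (1 - x - e₂) * (1 - x - f₃) * (1 - x) ^ m)) := by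
  -- the residual identity: Cauchy–Binet determinant of the rank-two parts minus the rung excess
  have key : 4 * ((1 + x) * (1 - x)) *
        (x ^ (u + 1) / 2 *
            ((1 + x + e₁) * (1 + x + f₂) * (1 + x) ^ u +
              (1 - x - e₁) * (1 - x - f₂) * (1 - x) ^ u) *
          (x ^ (m + 1) / 2 *
            ((1 + x + e₂) * (1 + x + f₃) * (1 + x) ^ m +
              (1 - x - e₂) * (1 - x - f₃) * (1 - x) ^ m))) -
      4 * ((1 + x) * (1 - x)) *
        (x ^ (u + m + 1 + 1) / 2 *
            ((1 + x + e₁) * (1 + x + f₃) * (1 + x) ^ (u + m + 1) -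
              (1 - x - e₁) * (1 - x - f₃) * (1 - x) ^ (u + m + 1)) *
          (x + e₂ + f₂)) =
      x ^ (u + 1) * x ^ (m + 1) *
          ((1 + x + e₁) * (1 - x - e₂) * (1 + x) ^ (u + 1) +
            (1 - x - e₁) * (1 + x + e₂) * (1 - x) ^ (u + 1)) *
          ((1 - x - f₂) * (1 + x + f₃) * (1 + x) ^ (m + 1) +
            (1 + x + f₂) * (1 - x - f₃) * (1 - x) ^ (m + 1)) -
        4 * x * e₂ * f₂ *
          (x ^ (u + m + 1 + 1) / 2 *
            ((1 + x + e₁) * (1 + x + f₃) * (1 + x) ^ (u + m + 1) -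
              (1 - x - e₁) * (1 - x - f₃) * (1 - x) ^ (u + m + 1))) := by
    ring
  -- the two brackets are at least their (nonnegative) first terms
  have hb1₀ : 0 ≤ (1 + x + e₁) * (1 - x - e₂) * (1 + x) ^ (u + 1) :=
    mul_nonneg (mul_nonneg (by linarith) (by linarith)) (pow_nonneg (by linarith) _)
  have hb1 : (1 + x + e₁) * (1 - x - e₂) * (1 + x) ^ (u + 1) ≤
      (1 + x + e₁) * (1 - x - e₂) * (1 + x) ^ (u + 1) +
        (1 - x - e₁) * (1 + x + e₂) * (1 - x) ^ (u + 1) :=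
    le_add_of_nonneg_right
      (mul_nonneg (mul_nonneg (by linarith) (by linarith)) (pow_nonneg (by linarith) _))
  have hb2₀ : 0 ≤ (1 - x - f₂) * (1 + x + f₃) * (1 + x) ^ (m + 1) :=
    mul_nonneg (mul_nonneg (by linarith) (by linarith)) (pow_nonneg (by linarith) _)
  have hb2 : (1 - x - f₂) * (1 + x + f₃) * (1 + x) ^ (m + 1) ≤
      (1 - x - f₂) * (1 + x + f₃) * (1 + x) ^ (m + 1) +
        (1 + x + f₂) * (1 - x - f₃) * (1 - x) ^ (m + 1) :=
    le_add_of_nonneg_right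
      (mul_nonneg (mul_nonneg (by linarith) (by linarith)) (pow_nonneg (by linarith) _))
  have hbb : x ^ (u + 1) * x ^ (m + 1) *
        ((1 + x + e₁) * (1 - x - e₂) * (1 + x) ^ (u + 1) *
          ((1 - x - f₂) * (1 + x + f₃) * (1 + x) ^ (m + 1))) ≤
      x ^ (u + 1) * x ^ (m + 1) *
        (((1 + x + e₁) * (1 - x - e₂) * (1 + x) ^ (u + 1) +
            (1 - x - e₁) * (1 + x + e₂) * (1 - x) ^ (u + 1)) *
          ((1 - x - f₂) * (1 + x + f₃) * (1 + x) ^ (m + 1) +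
            (1 + x + f₂) * (1 - x - f₃) * (1 - x) ^ (m + 1))) :=
    mul_le_mul_of_nonneg_left (mul_le_mul hb1 hb2 hb2₀ (hb1₀.trans hb1)) (by positivity)
  -- the common factor `T = x^{u+1} x^{m+1} a₁ b₃ P^{u+m+1}` and the scalar comparison
  have hT : 0 ≤ x ^ (u + 1) * x ^ (m + 1) * ((1 + x + e₁) * (1 + x + f₃)) * (1 + x) ^ (u + m + 1) := by
    positivity
  have hsc := mul_le_mul_of_nonneg_left (bbtt9Adj_scalar hx0 hx he₂ he₂' hf₂ hf₂') hT
  have e1 : x ^ (u + 1) * x ^ (m + 1) * ((1 + x + e₁) * (1 + x + f₃)) * (1 + x) ^ (u + m + 1) *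
        ((1 - x - e₂) * (1 - x - f₂) * (1 + x)) =
      x ^ (u + 1) * x ^ (m + 1) *
        ((1 + x + e₁) * (1 - x - e₂) * (1 + x) ^ (u + 1) *
          ((1 - x - f₂) * (1 + x + f₃) * (1 + x) ^ (m + 1))) := by
    ring
  -- the rung-excess term from above
  have hW := bbtt9Adj_cross_upper (u + m + 1) hx0 hx he₁' hf₃'
  have hWt : 4 * x * e₂ * f₂ *
        (x ^ (u + m + 1 + 1) / 2 *
          ((1 + x + e₁) * (1 + x + f₃) * (1 + x) ^ (u + m + 1) -
            (1 - x - e₁) * (1 - x - f₃) * (1 - x) ^ (u + m + 1))) ≤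
      4 * x * e₂ * f₂ *
        (x ^ (u + m + 1 + 1) / 2 * ((1 + x + e₁) * (1 + x + f₃) * (1 + x) ^ (u + m + 1))) :=
    mul_le_mul_of_nonneg_left hW (by positivity)
  have e2 : 4 * x * e₂ * f₂ *
        (x ^ (u + m + 1 + 1) / 2 * ((1 + x + e₁) * (1 + x + f₃) * (1 + x) ^ (u + m + 1))) =
      x ^ (u + 1) * x ^ (m + 1) * ((1 + x + e₁) * (1 + x + f₃)) * (1 + x) ^ (u + m + 1) *
        (2 * x * e₂ * f₂) := by
    ring
  -- conclusion: `4PM (SU - WR) ≥ 0` with `4PM > 0`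
  have hPM : (0 : ℝ) < 4 * ((1 + x) * (1 - x)) :=
    mul_pos (by norm_num) (mul_pos (by linarith) (by linarith))
  refine le_of_mul_le_mul_left ?_ hPM
  linarith [key, hbb, hsc, e1, hWt, e2]

/-! ## The stub -/

/-- **Tool stub `stub_ladder_bbtt9_adjacent`.** On the ladder `{0..L}×{0,1}`, for bottom sites
`(c₁,0), (c₂,0)`, the top site `(d₁,1)` with `c₁ < c₂ < d₁ ≤ L` and the top site `(c₂,1)` above
the second bottom site (cyclic order `(c₁,0),(c₂,0),(d₁,1),(c₂,1)`) and `0 ≤ x ≤ 1/2`: the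
crossing pairing weighs at most the ADJACENT one,
`Z((c₁,0),(d₁,1)) · Z((c₂,0),(c₂,1)) ≤ Z((c₁,0),(c₂,0)) · Z((d₁,1),(c₂,1))`. Mechanism: with the
rank-two form of the ladder kernels and the rung `x + E_{c₂} + E_{L-c₂}`, the difference
`Z₁₂ Z((d₁,1),(c₂,1)) - Z((c₁,0),(d₁,1)) Rung(c₂)` equals
`(x^{d+n}/4PM)[a₁a'₂P^d + a'₁a₂M^d][b'_{c₂}b_{d₁}P^n + b_{c₂}b'_{d₁}M^n] - δ_{c₂} Z((c₁,0),(d₁,1))`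
exactly (`d = c₂-c₁`, `n = d₁-c₂`, `δ_c = xE_cE_{L-c}/(PM)`), and the rung excess is dominated
through the scalar bound `2xE_{c₂}E_{L-c₂} ≤ a'_{c₂}b'_{c₂}P` (`E_k ≤ 1/6` on `[0,1/2]`).
[folklore] -/
theorem stub_ladder_bbtt9_adjacent (L : ℕ) {c₁ c₂ d₁ : ℕ} (h₁ : c₁ < c₂) (h₂ : c₂ < d₁) (h₃ : d₁ ≤ L)
    {x : ℝ} (hx0 : 0 ≤ x) (hx : x ≤ 1 / 2) :
    pathKernel (discreteDomainGraph (rectDomain L 1) 1) x (st c₁ 0) (st d₁ 1) *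
        pathKernel (discreteDomainGraph (rectDomain L 1) 1) x (st c₂ 0) (st c₂ 1) ≤
      pathKernel (discreteDomainGraph (rectDomain L 1) 1) x (st c₁ 0) (st c₂ 0) *
        pathKernel (discreteDomainGraph (rectDomain L 1) 1) x (st d₁ 1) (st c₂ 1) := by
  obtain ⟨u, hu⟩ : ∃ u, c₂ = c₁ + u + 1 := ⟨c₂ - c₁ - 1, by omega⟩
  obtain ⟨m, hm⟩ : ∃ m, d₁ = c₂ + m + 1 := ⟨d₁ - c₂ - 1, by omega⟩
  have hE := fun k => bbtt9Adj_E_nonneg hx0 k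
  have hE' := fun k => bbtt9Adj_E_le hx0 hx k
  rw [pathKernel_comm (discreteDomainGraph (rectDomain L 1) 1) x (st d₁ 1) (st c₂ 1),
    bbtt9Adj_kernel_cross L c₁ d₁ (u + m + 1) (by omega) h₃ hx0,
    stub_ladderRung L c₂ (by omega) hx0,
    bbtt9Adj_kernel_same L c₁ c₂ u (by omega) (by omega) hx0 0 (Or.inl rfl),
    bbtt9Adj_kernel_same L c₂ d₁ m (by omega) h₃ hx0 1 (Or.inr rfl),
    ← ENNReal.ofReal_mul
      (bbtt9Adj_cross_nonneg (u + m + 1) hx0 hx (hE c₁) (hE (L - d₁)) (hE' (L - d₁))),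
    ← ENNReal.ofReal_mul
      (bbtt9Adj_same_nonneg u hx0 hx (hE c₁) (hE' c₁) (hE (L - c₂)) (hE' (L - c₂)))]
  exact ENNReal.ofReal_le_ofReal (bbtt9Adj_real u m hx0 hx (hE c₁) (hE' c₁) (hE c₂) (hE' c₂)
    (hE (L - c₂)) (hE' (L - c₂)) (hE (L - d₁)) (hE' (L - d₁)))

end Summit.CriticalPhenomena.SAWScalingLimit.Theorems.BoundaryTP2
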